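import Mathlib
import HarnessLib
import Summits.NavierStokesRegularity.NavierStokesRegularity.Theorems.UnthreadedDoorCellFluxDefs
import Summits.NavierStokesRegularity.NavierStokesRegularity.Theorems.UnthreadedDoorCellFluxGaugeRigidityDivision
import Summits.NavierStokesRegularity.NavierStokesRegularity.Theorems.UnthreadedDoorCellFluxGaugeRigidityFrame

/-!
# Route `UnthreadedDoor`, crux `PoloidalLiouville` (stmt-NavierStokesRegularity-1222), WALL W1 — crux idea «cell-flux» (ns-idea-14,
# `Cruxes/PoloidalLiouville/CellFluxSketch.lean`): stub Σ-5a `UnthreadedGaugeRigidity`, PROVED (by name)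

`CellFlux.unthreadedGaugeRigidity : CellFlux.UnthreadedGaugeRigidity` (Defs twin p692073, body = sketch verbatim): an unthreaded bounded ancient
mild solution (`ν = 1`), jointly `C^∞` on the open slab, is EITHER jointly real-analytic in its given frame OR zonal at every time
(`∃ e ≠ 0, ⟪e, curl (v t) x⟫ = 0` for all `x`).  Owner ns-qj-p1 g7 (director-ns KEY-NS #218 (2)(b)); the custodian's SHORT ROAD, made
determinant-free:
(i) `exists_analytic_inertialFrame` (ARM A's `inertialGauge_of_smooth` p713033 + `oseenGauge_analyticOnNhd_uncurry`): a frame path `ξ ∈ C^∞(Iio 0)`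
with `V t y = v t (y + ξ t) − ξ′ t` jointly analytic on the slab; `analyticOnNhd_curl_uncurry`: so is `ω_V (t,y) = curl (V t) y = curl (v t) (y + ξ t)`.
(ii) Unthreadedness `curl (v t) x = ∇T × (x − x₀)` gives `⟪ω_V(t,y), y − z t⟫ = 0` with `z t = x₀ − ξ t` CONTINUOUS.
(iii) CASE A — some triple product `D(t₀) = ⟪ω₁, ω₂ × ω₃⟫(t₀) ≠ 0` (`ω_k = ω_V(·, y_k)`): the reciprocal-basis identity
`D • z = ⟪ω₁,y₁⟫•(ω₂×ω₃) + ⟪ω₂,y₂⟫•(ω₃×ω₁) + ⟪ω₃,y₃⟫•(ω₁×ω₂)` (`triple_smul_expand`) holds for ALL `t`, with `D` and the right side real-analytic in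
`t`; the division lemma `analyticOnNhd_of_smul_eq` (identity theorem on the connected `Iio 0` + orders of vanishing) makes `z`, hence `ξ` and `ξ′`,
analytic, and `uncurry v = uncurry V ∘ (t,x ↦ (t, x − ξ t)) + ξ′` is analytic: branch 1.
CASE B — all triple products vanish at every `t`: `exists_ne_zero_forall_inner_eq_zero` gives `e(t) ≠ 0` orthogonal to every `ω_V(t,·)`, i.e. to
every `curl (v t) x`: branch 2.
In the sketch: `theorem stub_unthreadedGaugeRigidity : UnthreadedGaugeRigidity := Theorems.PoloidalLiouville.CellFlux.unthreadedGaugeRigidity`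
(the sketch's stub may carry the extra hypothesis `NSSpaceTimeAnalyticityModGauge →`; then `fun _ => unthreadedGaugeRigidity`).

HONEST LABEL: one M− support stub of the cell-flux / indicatrix chains; `PoloidalLiouville` (1222), W1 and the summit stay OPEN; NO Navier–Stokes
regularity statement is proved.  `--supports stmt-NavierStokesRegularity-1222 --as helper`.
[cite: LemarieRieusset2016, Thm. 9.12; KochNadirashviliSereginSverak2009, §4 (i)]
-/

noncomputable section

-- the summit and its single sub-problem share the name (CONVENTIONS §1)
set_option linter.dupNamespace false

open Set Function Filter Topology InnerProductSpace MeasureTheory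
open scoped RealInnerProductSpace ContDiff

namespace Summit.NavierStokesRegularity.NavierStokesRegularity.Theorems.PoloidalLiouville.CellFlux

open Literature.Analysis Literature.Analysis.FluidPDE
open Summit.NavierStokesRegularity.NavierStokesRegularity.Theorems.PoloidalLiouville.HorizonTower (E3)
open Summit.NavierStokesRegularity.NavierStokesRegularity.Theorems.PoloidalLiouville.HorizonTower.Zonal (inner_cross_self_right)

/-- **Σ-5a `UnthreadedGaugeRigidity`** (statement = `CellFlux.UnthreadedGaugeRigidity` by name): an unthreaded bounded ancient mild solution, smooth
on the open slab, is either jointly real-analytic in its frame or zonal at every time.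
[cite: LemarieRieusset2016, Thm. 9.12; KochNadirashviliSereginSverak2009, §4 (i)] -/
theorem unthreadedGaugeRigidity : UnthreadedGaugeRigidity := by
  intro v x₀ T hv _hmeas hsm hcurl
  -- (i) the analytic inertial frame and its vorticity
  obtain ⟨ξ, hξ, hVan⟩ := exists_analytic_inertialFrame v hv hsm
  set V : ℝ → E3 → E3 := fun t y => v t (y + ξ t) - deriv ξ t with hVdef
  have hω : AnalyticOnNhd ℝ (fun p : ℝ × E3 => curl (V p.1) p.2) (Iio (0 : ℝ) ×ˢ (univ : Set E3)) :=
    analyticOnNhd_curl_uncurry hVan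
  have hcurlV : ∀ t y, curl (V t) y = curl (v t) (y + ξ t) := fun t y =>
    curl_translate_sub_const (v t) (ξ t) (deriv ξ t) y
  have hωt : ∀ y : E3, AnalyticOnNhd ℝ (fun t => curl (V t) y) (Iio 0) := by
    intro y t ht
    exact (hω (t, y) ⟨ht, mem_univ _⟩).comp₂ analyticAt_id analyticAt_const
  -- (ii) unthreadedness in the frame: `⟪ω_V(t,y), z t⟫ = ⟪ω_V(t,y), y⟫` with `z t = x₀ − ξ t` continuous
  set z : ℝ → E3 := fun t => x₀ - ξ t with hzdef
  have hzc : ContinuousOn z (Iio 0) := continuousOn_const.sub hξ.continuousOn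
  have horth : ∀ t < 0, ∀ y, ⟪curl (V t) y, z t⟫ = ⟪curl (V t) y, y⟫ := by
    intro t ht y
    have h1 : curl (V t) y = cross (gradient (T t) (y + ξ t)) (y - z t) := by
      rw [hcurlV, hcurl t ht]
      congr 1
      simp only [hzdef, sub_sub_eq_add_sub]
    have h2 : ⟪curl (V t) y, y - z t⟫ = 0 := by
      rw [h1]
      exact inner_cross_self_right _ _
    rw [inner_sub_right] at h2
    linarith
  by_cases hA : ∃ t₀, t₀ < 0 ∧ ∃ y₁ y₂ y₃ : E3, ⟪curl (V t₀) y₁, cross (curl (V t₀) y₂) (curl (V t₀) y₃)⟫ ≠ 0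
  · -- CASE A: an analytic frame with an analytic path
    left
    obtain ⟨t₀, ht₀, y₁, y₂, y₃, hD0⟩ := hA
    set a : ℝ → E3 := fun t => curl (V t) y₁ with hadef
    set b : ℝ → E3 := fun t => curl (V t) y₂ with hbdef
    set c : ℝ → E3 := fun t => curl (V t) y₃ with hcdef
    have ha : AnalyticOnNhd ℝ a (Iio 0) := hωt y₁
    have hb : AnalyticOnNhd ℝ b (Iio 0) := hωt y₂
    have hc : AnalyticOnNhd ℝ c (Iio 0) := hωt y₃
    have hza : ∀ t < 0, ⟪a t, z t⟫ = ⟪a t, y₁⟫ := fun t ht => horth t ht y₁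
    have hzb : ∀ t < 0, ⟪b t, z t⟫ = ⟪b t, y₂⟫ := fun t ht => horth t ht y₂
    have hzc' : ∀ t < 0, ⟪c t, z t⟫ = ⟪c t, y₃⟫ := fun t ht => horth t ht y₃
    set D : ℝ → ℝ := fun t => ⟪a t, cross (b t) (c t)⟫ with hDdef
    set N : ℝ → E3 := fun t =>
      ⟪a t, y₁⟫ • cross (b t) (c t) + ⟪b t, y₂⟫ • cross (c t) (a t) + ⟪c t, y₃⟫ • cross (a t) (b t) with hNdef
    have hDan : AnalyticOnNhd ℝ D (Iio 0) := fun t ht =>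
      analyticAt_inner (ha t ht) (analyticAt_cross (hb t ht) (hc t ht))
    have hNan : AnalyticOnNhd ℝ N (Iio 0) := fun t ht =>
      (((analyticAt_inner (ha t ht) analyticAt_const).smul (analyticAt_cross (hb t ht) (hc t ht))).add
        ((analyticAt_inner (hb t ht) analyticAt_const).smul (analyticAt_cross (hc t ht) (ha t ht)))).add
        ((analyticAt_inner (hc t ht) analyticAt_const).smul (analyticAt_cross (ha t ht) (hb t ht)))
    have hDz : ∀ t ∈ Iio (0 : ℝ), D t • z t = N t := by
      intro t ht
      have ht' : t < 0 := ht
      show ⟪a t, cross (b t) (c t)⟫ • z t = ⟪a t, y₁⟫ • cross (b t) (c t) + ⟪b t, y₂⟫ • cross (c t) (a t) + ⟪c t, y₃⟫ • cross (a t) (b t)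
      rw [triple_smul_expand, hza t ht', hzb t ht', hzc' t ht']
    have hD0' : D t₀ ≠ 0 := hD0
    have hzan : AnalyticOnNhd ℝ z (Iio 0) :=
      analyticOnNhd_of_smul_eq isOpen_Iio isPreconnected_Iio hDan hNan hzc hDz ht₀ hD0'
    -- `ξ = x₀ − z` and `ξ′` are analytic
    have hξan : AnalyticOnNhd ℝ ξ (Iio 0) := by
      have hξz : ξ = fun t => x₀ - z t := by
        funext t
        rw [hzdef]
        simp
      rw [hξz]
      exact fun t ht => analyticAt_const.sub (hzan t ht)
    have hξ'an : AnalyticOnNhd ℝ (deriv ξ) (Iio 0) := hξan.deriv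
    -- `uncurry v = uncurry V ∘ Φ + ξ′ ∘ fst`, `Φ (t,x) = (t, x − ξ t)`
    have hΦ : AnalyticOnNhd ℝ (fun p : ℝ × E3 => (p.1, p.2 - ξ p.1)) (Iio (0 : ℝ) ×ˢ (univ : Set E3)) := fun p hp =>
      analyticAt_fst.prod (analyticAt_snd.sub ((hξan p.1 hp.1).comp analyticAt_fst))
    have hmaps : MapsTo (fun p : ℝ × E3 => (p.1, p.2 - ξ p.1)) (Iio (0 : ℝ) ×ˢ (univ : Set E3)) (Iio (0 : ℝ) ×ˢ (univ : Set E3)) :=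
      fun p hp => ⟨hp.1, mem_univ _⟩
    have hcomp := hVan.comp hΦ hmaps
    have hsum : AnalyticOnNhd ℝ
        (fun p : ℝ × E3 => ((uncurry fun t y => v t (y + ξ t) - deriv ξ t) ∘ fun p : ℝ × E3 => (p.1, p.2 - ξ p.1)) p + deriv ξ p.1)
        (Iio (0 : ℝ) ×ˢ (univ : Set E3)) := fun p hp =>
      (hcomp p hp).add ((hξ'an p.1 hp.1).comp analyticAt_fst)
    refine hsum.congr isOpen_slab ?_
    rintro ⟨t, x⟩ ⟨-, -⟩
    simp
  · -- CASE B: zonal at every time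
    right
    intro t ht
    push Not at hA
    obtain ⟨e, he, hperp⟩ :=
      exists_ne_zero_forall_inner_eq_zero (fun y => curl (V t) y) (fun y₁ y₂ y₃ => hA t ht y₁ y₂ y₃)
    refine ⟨e, he, fun x => ?_⟩
    have hx : curl (v t) x = curl (V t) (x - ξ t) := by rw [hcurlV, sub_add_cancel]
    rw [hx]
    exact hperp _

/-- Alias under the sketch's stub name (CellFluxSketch Σ-5a `stub_unthreadedGaugeRigidity`, form without the HH-0⁺ hypothesis). [folklore] -/
theorem stub_unthreadedGaugeRigidity' : UnthreadedGaugeRigidity := unthreadedGaugeRigidity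

/-- The sketch v1.2.5+ form `NSSpaceTimeAnalyticityModGauge → UnthreadedGaugeRigidity` (the hypothesis is not needed). [folklore] -/
theorem unthreadedGaugeRigidity_of_modGauge : NSSpaceTimeAnalyticityModGauge → UnthreadedGaugeRigidity :=
  fun _ => unthreadedGaugeRigidity

end Summit.NavierStokesRegularity.NavierStokesRegularity.Theorems.PoloidalLiouville.CellFlux

end
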